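import Summits.ResolutionOfSingularities.ResolutionOfSingularities.Theorems.FrobeniusLadderFRationalResolutionFixedPointLogRegularNhd
import Summits.ResolutionOfSingularities.ResolutionOfSingularities.Theorems.FrobeniusLadderFRationalResolutionChartNormalization
import Literature.AlgebraicGeometry.Resolution.LogRegularResolutionHolds
import Literature.AlgebraicGeometry.Resolution.LogRegularScheme
import HarnessLib

/-!
# Crux `FrobeniusLadder.FRationalResolution` (stmt-ResolutionOfSingularities-15317), line `redirect`,
# stub `stub_diagonalizableQuotientResolution` — **every `D(A)`-fixed point of the quotient chart
# `Spec S₀` has an invariant affine neighbourhood `Spec (S₀)_g` WITH A RESOLUTION OF SINGULARITIES**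
# (every field, tame or wild), by Kato's resolution of log-regular schemes (PROVED in the tree,
# `Kato1994_logRegular_hasResolution_holds`)

`S` a REGULAR algebra of finite type over a field `k`, graded by a torsion abelian group `A`,
`𝔔 ⊇ S_a` (`a ≠ 0`) a prime, `𝔮 = 𝔔 ∩ S₀`. `…FixedPointLogRegularNhd` gives `g ∈ S₀ ∖ 𝔮` with the
monomial chart `φ : P → S₀` Kato-log-regular at every prime of `D(g) ⊆ Spec S₀`. Here:
(1) generic transport — Kato's (2.1) passes from `(A, φ)` at `𝔓 ∩ A` to a localization `(B, ι ∘ φ)`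
at `𝔓` (`B_𝔓 = A_{𝔓 ∩ A}`), so a chart log regular off `V(g)` is log regular at every prime of
`A_g`, and `Spec A_g` is resolved by Kato (10.4) once the chart monoid is fs and spanning;
(2) the chart normalisation of `…ChartNormalization`, restated with the equivalence at ALL primes
for one re-parametrisation; (3) the corollary `exists_hasResolution_away_of_fixed`.

* `isLogRegularAt_of_isLocalization` — (2.1) along a localization;
* `hasResolution_away_of_forall_isLogRegularAt` — `Spec A_g` has a resolution if an fs spanning chart
  on `A` is log regular at every prime not containing `g`;
* `exists_normalized_chart_forall` — `…ChartNormalization.exists_normalized_chart`, all primes at once;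
* **`exists_hasResolution_away_of_fixed`** — the theorem of the title.

Honest label: the fixed-point route's END POINT (étale-local resolvability of diagonalizable
quotient singularities at fixed points, all fields); NOT the stub (`Scheme.HasResolution X` needs
gluing / functoriality = Bergh–Rydh destackification, or the non-fixed wild points). No definitions,
no named facts, no sorry. [cite: Kato1994, Def. (2.1), (10.4)]
-/

noncomputable section

-- single-problem summit: the doubled namespace component is forced
set_option linter.dupNamespace false

open AlgebraicGeometry Literature.AlgebraicGeometry.Resolution
open Literature.AlgebraicGeometry.Resolution.DiagonalizableQuotient

namespace Summit.ResolutionOfSingularities.ResolutionOfSingularities.Theorems.FRationalResolution.FixedPointResolvableNhd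

universe u w

/-! ## (1) Kato's condition along a localization; resolution of `Spec A_g` -/

/-- **Kato's (2.1) passes to a localization**: for `B` a localization of `A`, a chart `φ : P → A`
and a prime `𝔓` of `B`, if `(A, φ)` is log regular at `𝔓 ∩ A` then `(B, ι ∘ φ)` is log regular at
`𝔓` (the local rings `B_𝔓 = A_{𝔓 ∩ A}` agree, compatibly with the charts). [cite: Kato1994, Def. (2.1)] -/
theorem isLogRegularAt_of_isLocalization {R B : Type u} [CommRing R] [CommRing B] [Algebra R B]
    (M : Submonoid R) [IsLocalization M B] {n : ℕ} (P : AddSubmonoid (Fin n → ℤ))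
    (φ : Multiplicative P →* R) (𝔓 : Ideal B) [𝔓.IsPrime]
    (h : LogChart.IsLogRegularAt P φ (𝔓.comap (algebraMap R B))) :
    LogChart.IsLogRegularAt P ((algebraMap R B).toMonoidHom.comp φ) 𝔓 := by
  rw [LogChart.isLogRegularAt_iff_isLogRegularLocal] at h ⊢
  haveI : IsLocalization.AtPrime (Localization.AtPrime 𝔓) (𝔓.comap (algebraMap R B)) :=
    IsLocalization.isLocalization_isLocalization_atPrime_isLocalization M
      (Localization.AtPrime 𝔓) 𝔓
  let e : Localization.AtPrime (𝔓.comap (algebraMap R B)) ≃ₐ[R] Localization.AtPrime 𝔓 :=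
    IsLocalization.algEquiv (𝔓.comap (algebraMap R B)).primeCompl _ _
  have hcomp : (algebraMap B (Localization.AtPrime 𝔓)).toMonoidHom.comp
      ((algebraMap R B).toMonoidHom.comp φ) =
      (e : Localization.AtPrime (𝔓.comap (algebraMap R B)) ≃+*
        Localization.AtPrime 𝔓).toMonoidHom.comp
        ((algebraMap R (Localization.AtPrime (𝔓.comap (algebraMap R B)))).toMonoidHom.comp φ) := by
    ext p
    change algebraMap B (Localization.AtPrime 𝔓) (algebraMap R B (φ p)) =
      e (algebraMap R (Localization.AtPrime (𝔓.comap (algebraMap R B))) (φ p))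
    rw [AlgEquiv.commutes, ← IsScalarTower.algebraMap_apply]
  rw [hcomp, LogChart.isLogRegularLocal_comp_equiv]
  exact h

/-- **`Spec A_g` is resolved when an fs spanning chart on `A` is log regular off `V(g)`** (Noetherian
`A`): the chart `A → A_g` is log regular at every prime of `A_g` (`isLogRegularAt_of_isLocalization`),
and Kato 1994 (10.4) — PROVED in the tree, `Kato1994_logRegular_hasResolution_holds` — resolves
`Spec A_g`. [cite: Kato1994, (10.4)] -/
theorem hasResolution_away_of_forall_isLogRegularAt {R : Type u} [CommRing R] [IsNoetherianRing R]
    {n : ℕ} (P : AddSubmonoid (Fin n → ℤ)) (φ : Multiplicative P →* R) (hfg : P.FG)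
    (hsat : ∀ (v : Fin n → ℤ) (m : ℕ), 0 < m → m • v ∈ P → v ∈ P)
    (hspan : Submodule.span ℤ (P : Set (Fin n → ℤ)) = ⊤) (g : R)
    (h : ∀ (𝔮 : Ideal R) [𝔮.IsPrime], g ∉ 𝔮 → LogChart.IsLogRegularAt P φ 𝔮) :
    Scheme.HasResolution (Spec (.of (Localization.Away g))) := by
  haveI : IsNoetherianRing (Localization.Away g) :=
    IsLocalization.isNoetherianRing (Submonoid.powers g) _ inferInstance
  refine Kato1994_logRegular_hasResolution_holds (Localization.Away g) n P
    ((algebraMap R (Localization.Away g)).toMonoidHom.comp φ) hfg hsat hspan fun 𝔓 _ => ?_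
  refine isLogRegularAt_of_isLocalization (Submonoid.powers g) P φ 𝔓 (h _ fun hg => ?_)
  exact ‹𝔓.IsPrime›.ne_top (Ideal.eq_top_of_isUnit_mem _ (Ideal.mem_comap.mp hg)
    (IsLocalization.Away.algebraMap_isUnit g))

/-! ## (2) Chart normalisation, all primes at once -/

/-- **Chart normalisation (all primes).** For `aᵢ` of finite order, every chart `φ` on
`P = ℤⁿ_{≥0} ⊓ ker(m ↦ Σ mᵢ aᵢ)` can be re-parametrised along ONE monoid isomorphism `e : P' ≃ P` with
`P' ⊆ ℤⁿ` finitely generated, saturated in `ℤⁿ` and spanning `ℤⁿ`, without changing Kato's condition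
at ANY prime (same construction as `…ChartNormalization.exists_normalized_chart`, whose statement
fixes the prime first). [cite: Kato1994, (1.5), Def. (2.1)] -/
theorem exists_normalized_chart_forall {A' : Type w} [AddCommGroup A'] {n : ℕ} (a : Fin n → A')
    {A : Type u} [CommRing A] (ha : ∀ i, IsOfFinAddOrder (a i))
    (φ : Multiplicative ↥(AddSubmonoid.nonneg (Fin n → ℤ) ⊓
      AddMonoidHom.mker (Fintype.linearCombination ℤ a).toAddMonoidHom) →* A) :
    ∃ (P' : AddSubmonoid (Fin n → ℤ))
      (e : ↥P' ≃+ ↥(AddSubmonoid.nonneg (Fin n → ℤ) ⊓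
        AddMonoidHom.mker (Fintype.linearCombination ℤ a).toAddMonoidHom)),
      P'.FG ∧ P'.NSMulSaturated ∧ Submodule.span ℤ (P' : Set (Fin n → ℤ)) = ⊤ ∧
      ∀ (𝔭 : Ideal A) [𝔭.IsPrime],
        (LogChart.IsLogRegularAt P' (φ.comp (AddMonoidHom.toMultiplicative e.toAddMonoidHom)) 𝔭 ↔
          LogChart.IsLogRegularAt _ φ 𝔭) := by
  -- adapted from `…ChartNormalization.exists_normalized_chart` (prime moved inside)
  classical
  have hfgP := ChartMonoidFG.fg_nonneg_inf_mker a ha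
  have hspanP := ChartNormalization.span_eq_ker a ha
  have hmemP := ChartNormalization.mem_chartMonoid_iff a
  generalize (AddSubmonoid.nonneg (Fin n → ℤ) ⊓
    AddMonoidHom.mker (Fintype.linearCombination ℤ a).toAddMonoidHom) = P at φ hfgP hspanP hmemP ⊢
  obtain ⟨L, hL, hrange⟩ := KernelLattice.exists_linearMap_range_eq_ker a ha
  let P' : AddSubmonoid (Fin n → ℤ) := P.comap L.toAddMonoidHom
  -- the monoid isomorphism `P' ≃ P`
  let f : ↥P' →+ ↥P :=
    { toFun := fun p' => ⟨L p'.1, p'.2⟩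
      map_zero' := Subtype.ext (map_zero L)
      map_add' := fun x y => Subtype.ext (map_add L x.1 y.1) }
  have hfinj : Function.Injective f := fun x y h =>
    Subtype.ext (hL (congrArg Subtype.val h))
  have hfsurj : Function.Surjective f := by
    rintro ⟨p, hp⟩
    have hpker : p ∈ LinearMap.ker (Fintype.linearCombination ℤ a) :=
      ((hmemP p).mp hp).2
    rw [← hrange] at hpker
    obtain ⟨v, hv⟩ := hpker
    refine ⟨⟨v, show L.toAddMonoidHom v ∈ P by rw [LinearMap.toAddMonoidHom_coe, hv]; exact hp⟩,
      Subtype.ext hv⟩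
  let e : ↥P' ≃+ ↥P := AddEquiv.ofBijective f ⟨hfinj, hfsurj⟩
  have heL : ∀ p' : ↥P', L p'.1 = (e p').1 := fun p' => rfl
  have himage : L '' (P' : Set (Fin n → ℤ)) = (P : Set (Fin n → ℤ)) := by
    ext p
    constructor
    · rintro ⟨v, hv, rfl⟩
      exact hv
    · intro hp
      obtain ⟨⟨v, hv⟩, hvp⟩ := hfsurj ⟨p, hp⟩
      exact ⟨v, hv, congrArg Subtype.val hvp⟩
  refine ⟨P', e, ?_, ?_, ?_, fun 𝔭 _ => ?_⟩
  · -- finitely generated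
    haveI : AddMonoid.FG ↥P := (AddMonoid.fg_iff_addSubmonoid_fg P).mpr hfgP
    have hfg' : AddMonoid.FG ↥P' := AddMonoid.fg_of_surjective e.symm.toAddMonoidHom e.symm.surjective
    exact (AddMonoid.fg_iff_addSubmonoid_fg P').mp hfg'
  · -- saturated
    intro k v hkv
    by_cases hk : k = 0
    · exact Or.inl hk
    · right
      change L.toAddMonoidHom (k • v) ∈ P at hkv
      change L.toAddMonoidHom v ∈ P
      rw [LinearMap.toAddMonoidHom_coe] at hkv ⊢
      rw [map_nsmul] at hkv
      obtain ⟨hnn, -⟩ := (hmemP _).mp hkv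
      rw [hmemP]
      refine ⟨fun i => ?_, ?_⟩
      · have h := hnn i
        simp only [Pi.smul_apply, nsmul_eq_mul, Pi.zero_apply] at h
        have hkpos : (0 : ℤ) < k := by exact_mod_cast Nat.pos_of_ne_zero hk
        exact (mul_nonneg_iff_of_pos_left hkpos).mp h
      · have hmem : L v ∈ LinearMap.range L := ⟨v, rfl⟩
        rw [hrange] at hmem
        exact hmem
  · -- spanning
    apply Submodule.map_injective_of_injective hL
    rw [Submodule.map_span, himage, hspanP, ← hrange, Submodule.map_top]
  · exact LogChartTransport.isLogRegularAt_comp_iff P P' e φ L hL heL 𝔭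

/-! ## (3) The fixed-point neighbourhood is resolvable -/

variable {k : Type u} [Field k] {A : Type w} [DecidableEq A] [AddCommGroup A] {S : Type u}
  [CommRing S] [Algebra k S] (𝒮 : A → Submodule k S) [GradedAlgebra 𝒮]

/-- **Every fixed point of the quotient chart has a resolvable invariant affine neighbourhood.**
`S` regular of finite type over a field `k` (any characteristic, any field), graded by a torsion
abelian group `A`; `𝔔` a prime of `S` containing every `S_a`, `a ≠ 0` (a `D(A)`-fixed point). Then
there is `g ∈ S₀ ∖ 𝔔` such that the affine scheme `Spec (S₀)_g` — an open neighbourhood of the image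
`𝔮 = 𝔔 ∩ S₀` of the fixed point in `Spec S₀ = Spec S / D(A)` — has a resolution of singularities.
[cite: Kato1994, Def. (2.1), (10.4)] -/
theorem exists_hasResolution_away_of_fixed [IsRegularRing S] [Algebra.FiniteType k S]
    (hA : AddMonoid.IsTorsion A) (𝔔 : Ideal S) [𝔔.IsPrime]
    (hfix : ∀ a : A, a ≠ 0 → ∀ s ∈ 𝒮 a, s ∈ 𝔔) :
    ∃ g : 𝒮 0, (g : S) ∉ 𝔔 ∧ Scheme.HasResolution (Spec (.of (Localization.Away g))) := by
  obtain ⟨n, x, a, -, -, φ, -, g, hg, hreg⟩ :=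
    FixedPointLogRegularNhd.exists_nhd_isLogRegularAt_of_fixed 𝒮 hA 𝔔 hfix
  have ha : ∀ i, IsOfFinAddOrder (a i) := fun i => hA (a i)
  obtain ⟨P', e, hfg, hsat, hspan, hiff⟩ := exists_normalized_chart_forall a ha φ
  haveI : IsNoetherianRing (𝒮 0) := isNoetherianRing_gradeZero 𝒮 hA
  refine ⟨g, hg, hasResolution_away_of_forall_isLogRegularAt P'
    (φ.comp (AddMonoidHom.toMultiplicative e.toAddMonoidHom)) hfg
    (fun v m hm hmv => (hsat hmv).resolve_left (Nat.pos_iff_ne_zero.mp hm)) hspan g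
    fun 𝔮 h𝔮 hg𝔮 => ?_⟩
  have hmem : g ∉ 𝔮 := hg𝔮
  exact (@hiff 𝔮 h𝔮).mpr (@hreg 𝔮 h𝔮 hmem)

end Summit.ResolutionOfSingularities.ResolutionOfSingularities.Theorems.FRationalResolution.FixedPointResolvableNhd

end
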